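/-
Origin: expansion seat `planner-pub-hodgecm-pv11-0`, handover 2026-08-18T04:13:26Z (`HOME/pub-hodgecm-pv11/lean/Pv11/EulerDatumOfL1.lean`, md5 8ceec78f, 90 lines);
landed by the gen-5 packager in gate run 21 as `HodgeCM/PerL34/EulerDatumOfL1.lean` (import ^import Pv[0-9]+copy\.(?:PerL34\.)?→import HodgeCM.PerL34. ×1; import ^import Pv[0-9]+\.→import HodgeCM.PerL34. ×1).
-/
import Summits.HodgeConjecture.HodgeCM.PerL34.EulerFactorisation
import Summits.HodgeConjecture.HodgeCM.PerL34.AdelicFactorisation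

/-!
# pv13's `EulerFactorisation.Datum` with its two ANALYTIC fields DISCHARGED (Leahy Prop. 3.1.9 (ii))

By-name glue between the two seam-(I) files of GAPS `pv05-X1` (N31e → N31 `rallis`):

* pv13, `HodgeCM/PerL34/EulerFactorisation.lean` (handover 04:08:43Z, md5 a223e9a4; imported here from the
  byte-identical copy `Pv13copy/EulerFactorisation.lean` → rewrite to `HodgeCM.PerL34.EulerFactorisation`):
  `EulerFactorisation.Datum μ F V` POSITS, besides the restricted-product structure, the two analytic
  inputs `integrable : Integrable F μ` (tex l. 608 "converges absolutely") and
  `multipliable : Multipliable (fun v => ∫ f_v)`.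
* pv11, `HodgeCM/PerL34/AdelicFactorisation.lean`: over the measure-only datum
  `RestrictedProductMeasureDatum` both are THEOREMS (`integrable`, `multipliable_integral`) from local
  integrability `hfl` and a bound `hB` on the partial Euler products of the local `L¹`-norms — the
  "Furthermore, if ∏_ν(∫|f_ν|) = lim_S ∏_{ν∈S}(∫|f_ν|) < ∞, then ∫_G f = ∏_ν ∫ f_ν and f ∈ L¹(G)" clause of
  Leahy, *An introduction to Tate's Thesis* (McGill 2010), Prop. 3.1.9 (ii), PDF p. 91 (quoted verbatim in
  `AdelicFactorisation.lean`).

`toEulerDatum` builds pv13's `Datum` with those two fields PROVED; `hEuler_via_pv13` then reads pv09's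
`hEuler` off pv13's `Datum.hEuler_of`, so the two vocabularies agree by `rfl` on the local factors.
KERNEL only (no new data, nothing cited as a hypothesis).  Unit `pub-hodgecm-pv11`, 2026-08-18.
-/

set_option autoImplicit false

noncomputable section

open MeasureTheory Filter Topology

namespace HodgeCM.PerL34.AdelicFactorisation.RestrictedProductMeasureDatum

variable {ι : Type} [Countable ι] [DecidableEq ι] {G : ι → Type} [∀ i, MeasurableSpace (G i)]
  {A : Type} [MeasurableSpace A]
variable (D : RestrictedProductMeasureDatum ι G A) {T : Finset ι} {f : A → ℂ} {fl : ∀ i, G i → ℂ}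

/-- pv13's `EulerFactorisation.Datum D.μ f ι` BUILT from the measure datum `D`, a pure tensor `f = ⊗ f_i`
(`hf`), measurability (`hfm`), local integrability (`hfl`) and the `L¹` Euler bound (`hB`): the fields
`integrable` and `multipliable` are the THEOREMS `integrable` / `multipliable_integral` of
`AdelicFactorisation.lean`; every other field is a field of `D` (exceptional set `S₀ ∪ T`). -/
def toEulerDatum (hf : D.IsPureTensor T f fl) (hfm : AEStronglyMeasurable f D.μ)
    (hfl : ∀ i, Integrable (fl i) (D.ν i))
    (hB : ∃ B : ℝ, ∀ S : Finset ι, D.S₀ ⊆ S → T ⊆ S → ∏ i ∈ S, ∫ x, ‖fl i x‖ ∂D.ν i ≤ B) :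
    EulerFactorisation.Datum D.μ f ι where
  S₀ := D.S₀ ∪ T
  Gv := G
  μv := D.ν
  fv := fl
  G := D.Aset
  G_meas := D.measurableSet_Aset
  G_mono := D.mono
  G_cover := D.exhaust
  Y := D.C
  ν := D.ρ
  emb := D.e
  emb_measurableEmbedding := fun S _ => D.emb S
  map_emb := fun S hS => (D.restrict_eq S fun _ hx => hS (Finset.mem_union_left T hx)).symm
  pure_tensor := fun S hS p => hf S (fun _ hx => hS (Finset.mem_union_right D.S₀ hx)) p
  integrable := integrable hf hfm hfl hB
  multipliable := multipliable_integral hf hfm hfl hB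

/-- The local factors of the built datum are `∫ f_i dν_i` (definitional). -/
theorem toEulerDatum_I (hf : D.IsPureTensor T f fl) (hfm : AEStronglyMeasurable f D.μ)
    (hfl : ∀ i, Integrable (fl i) (D.ν i))
    (hB : ∃ B : ℝ, ∀ S : Finset ι, D.S₀ ⊆ S → T ⊆ S → ∏ i ∈ S, ∫ x, ‖fl i x‖ ∂D.ν i ≤ B) (i : ι) :
    (D.toEulerDatum hf hfm hfl hB).I i = ∫ x, fl i x ∂D.ν i := rfl

/-- pv09's `hEuler` read off pv13's `Datum.hEuler_of` for the built datum: given real local values `I_i`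
and ANY `HasProd I P` (e.g. pv13 `EulerProduct.hasProd_eulerValue`), `∫_A f dμ = (P : ℂ)`. -/
theorem hEuler_via_pv13 (hf : D.IsPureTensor T f fl) (hfm : AEStronglyMeasurable f D.μ)
    (hfl : ∀ i, Integrable (fl i) (D.ν i))
    (hB : ∃ B : ℝ, ∀ S : Finset ι, D.S₀ ⊆ S → T ⊆ S → ∏ i ∈ S, ∫ x, ‖fl i x‖ ∂D.ν i ≤ B)
    {I : ι → ℝ} {P : ℝ} (hI : ∀ i, ∫ x, fl i x ∂D.ν i = (I i : ℂ)) (hP : HasProd I P) :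
    ∫ a, f a ∂D.μ = (P : ℂ) :=
  (D.toEulerDatum hf hfm hfl hB).hEuler_of (fun i => by rw [toEulerDatum_I]; exact hI i) hP

omit [DecidableEq ι] in
/-- Consistency of the two routes: the `P` of any `HasProd I P` IS `∏' i, I i`, and both files give the
same value of the adelic integral. -/
theorem hEuler_routes_agree (hf : D.IsPureTensor T f fl) (hfm : AEStronglyMeasurable f D.μ)
    (hfl : ∀ i, Integrable (fl i) (D.ν i))
    (hB : ∃ B : ℝ, ∀ S : Finset ι, D.S₀ ⊆ S → T ⊆ S → ∏ i ∈ S, ∫ x, ‖fl i x‖ ∂D.ν i ≤ B)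
    {I : ι → ℝ} {P : ℝ} (hI : ∀ i, ∫ x, fl i x ∂D.ν i = (I i : ℂ)) (hP : HasProd I P) :
    P = ∏' i, I i ∧ ∫ a, f a ∂D.μ = ((∏' i, I i : ℝ) : ℂ) :=
  ⟨hP.tprod_eq.symm, integral_eq_ofReal_tprod hf hfm hfl hB hI⟩

end HodgeCM.PerL34.AdelicFactorisation.RestrictedProductMeasureDatum

end
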